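import Literature.AlgebraicGeometry.Motives.GrassmannianUniversalChartData
import Literature.AlgebraicGeometry.Motives.GrassmannianOneProjective
import Literature.AlgebraicGeometry.Motives.GeneratingSectionsSerreTwistClass
import Literature.AlgebraicGeometry.Modules.LineBundleOfCocycleClass
import HarnessLib

/-!
# Plücker data on the Grassmannian: the determinant frame system of the universal quotient and the Plücker sections

Topic `AlgebraicGeometry/Motives`; namespace `Literature.AlgebraicGeometry.Motives.Grassmannian`.  Cell `hodgecm-mathlib`
(D-0151), F-13 «Plücker class of the linearly rigidified covariant», row **P2a** of the census-first memo
`B-provers/B-p10/g13/CENSUS-F13-PluckerPL.B-p10g13.md` — the DATA half (DEF lane) of the P2a pair; the class identity and the closed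
immersion `θ : Gr ⟶ 𝐏ʳ_ℤ` are proved in the sequel `Motives/GrassmannianPluckerToPP` (PROOF lane, no definitions).  Count-neutral
Mathlib-side capital: HC_CM is proved only modulo the 7 printed citations until rung 0 closes — nothing here bears on a summit statement.

For a finite free abelian group `M` with basis `b : J → M` and `Gr = grassmannianScheme M k` (★ `GrassmannianSheaf`) with its
universal rank-`k` quotient `𝒬 = universalQuotient k M b` (★ `GrassmannianUniversalChartData`, glued from the standard charts
`U_I`, `I : Fin k ↪ J`, along the transition cocycle `g_{II'}` of ★ `GrassmannianChartTransition`), the Plücker morphism is written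
WITHOUT exterior powers ([GortzWedhorn2020] (8.10); [EisenbudHarris2016] §3.2.2): its line bundle is the DETERMINANT LINE BUNDLE `det 𝒬`,
realised as the cocycle line bundle (★ `Modules.lineBundle`) of the determinant cocycle `det g_{II'}` of the frames of `𝒬`, and its
sections are the MAXIMAL MINORS `p_I = det (I-columns of the universal coordinate matrix)` (★ `ChartData.transitionAt`).  This file
fixes the four pieces of data and their defining computations:

* §1 `chartAt` (one standard chart `U_{chartAt t} ∋ t` per point) and `detFrameSystem` — the frame system of `𝒬` on these charts, with
  determinant cocycle `detFrameSystem_cocycle_g = det (transition …)` (★ `MatrixCocycle.transition_frame`); hence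
  `detClass_universalQuotient_eq_mk : [det 𝒬] = CechPic.mk detFrameSystem.cocycle` (★ `detClass_eq_mk`).
* §2 `pluckerFamily d` (the glue family `x ↦ det (transitionAt (chartAt x) d)`, glue law = ★ `transitionAt_mul` + `Matrix.det_mul`) and
  `pluckerSection d ∈ Γ(det 𝒬, Gr)`, with its coefficient in the canonical frame `coeffAt_pluckerSection = det (transitionAt (chartAt x) d)`
  and `x ∈ Gr_{p_{chartAt x}}`.
* §3 `pluckerCocycleSections e`∕`pluckerDatum e he` — the cocycle-sections datum of `p_{e 0}, …, p_{e n}` and, when every chart occurs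
  among the `e i`, the generating-sections datum of [Hartshorne1977] II Thm. 7.1 (★ `GeneratingSections.ofCocycleSections`).

## References
* [GortzWedhorn2020] U. Görtz, T. Wedhorn, *Algebraic Geometry I*, 2nd ed. (2020), (8.10), Prop. 8.23 (p. 220); (8.4) (pp. 213–215).
* [EisenbudHarris2016] D. Eisenbud, J. Harris, *3264 and All That* (2016), §3.2.2.
* [Hartshorne1977] R. Hartshorne, *Algebraic Geometry* (1977), II Thm. 7.1, proof of Thm. 7.1 (p. 150); II Ex. 5.16, Ex. 5.18, Ex. 6.11.
* [StacksProject] The Stacks project, Tag 089T.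
-/

noncomputable section
-- `TopCat.Presheaf`/`Scheme.Modules` are not reducible (as in Mathlib's `AlgebraicGeometry/Modules/Sheaf.lean`).
set_option backward.isDefEq.respectTransparency false

namespace Literature.AlgebraicGeometry.Motives.Grassmannian

open CategoryTheory Opposite TopologicalSpace _root_.AlgebraicGeometry
open Literature.AlgebraicGeometry.Modules Literature.AlgebraicGeometry.Motives.GeneratingSections

universe u

variable (k : ℕ) (M : Type u) [AddCommGroup M] {J : Type u} (b : Module.Basis J ℤ M)
  [(grassmannianSheaf M k).obj.IsRepresentable]

/-- Two sections of `𝒪_T` over an open `V` that agree on every affine open `W ≤ V` are equal. [folklore] -/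
private theorem section_ext_of_affine {T : Scheme.{u}} {V : T.Opens} (s t : Γ(T, V))
    (h : ∀ (W : T.Opens), IsAffineOpen W → ∀ (i : W ≤ V), Modules.secRes T i s = Modules.secRes T i t) : s = t := by
  refine TopCat.Sheaf.eq_of_locally_eq' T.sheaf (fun W : {W : T.affineOpens // (W : T.Opens) ≤ V} => (W.1 : T.Opens))
    V (fun W => homOfLE W.2) ?_ s t fun W => h W.1.1 W.1.2 W.2
  intro y hy
  obtain ⟨W, hW, hyW, hWV⟩ := Opens.isBasis_iff_nbhd.mp T.isBasis_affineOpens hy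
  exact Opens.mem_iSup.mpr ⟨⟨⟨W, hW⟩, hWV⟩, hyW⟩

/-! ## §1 The chart choice and the determinant frame system of the universal quotient -/

/-- A standard chart `U_{chartAt t}` containing the point `t ∈ Gr` (★ `exists_mem_universalChartData_U`).
[cite: StacksProject, Tag 089T] -/
def chartAt (t : grassmannianScheme M k) : {I : Fin k → J // Function.Injective I} :=
  (exists_mem_universalChartData_U k M b t).choose

/-- `t ∈ U_{chartAt t}`. [cite: StacksProject, Tag 089T] -/
theorem mem_U_chartAt (t : grassmannianScheme M k) : t ∈ (universalChartData k M b).U (chartAt k M b t) :=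
  (exists_mem_universalChartData_U k M b t).choose_spec

/-- **The frame system of the universal quotient `𝒬` on the standard charts**: at `t` the tautological frame over
`U_{chartAt t}` (★ `MatrixCocycle.frame` of the transition cocycle ★ `ChartData.cocycle`).
[cite: GortzWedhorn2020, (8.4) (pp. 213–215)] [cite: Hartshorne1977, II Ex. 5.18] -/
def detFrameSystem : FrameSystem (universalQuotient k M b) where
  U t := (universalChartData k M b).U (chartAt k M b t)
  mem t := mem_U_chartAt k M b t
  I _ := ULift.{u} (Fin k)
  rank _ := k
  enum _ := Equiv.ulift
  frame t := (universalChartData k M b).cocycle.frame (chartAt k M b t)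

/-- The opens of the determinant frame system are the chosen charts (`rfl`). [cite: StacksProject, Tag 089T] -/
@[simp]
theorem detFrameSystem_U (t : grassmannianScheme M k) :
    (detFrameSystem k M b).U t = (universalChartData k M b).U (chartAt k M b t) :=
  rfl

/-- **The determinant cocycle of `𝒬` is `det g`**: the cocycle of the frame system `detFrameSystem` over `V ≤ U_{chartAt x} ⊓ U_{chartAt y}`
is the determinant of the transition matrix `g_{chartAt x, chartAt y}` (★ `MatrixCocycle.transition_frame`).
[cite: Hartshorne1977, II Ex. 5.16] [cite: GortzWedhorn2020, (8.4) (pp. 213–215)] -/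
theorem detFrameSystem_cocycle_g (x y : grassmannianScheme M k) (V : (grassmannianScheme M k).Opens)
    (hx : V ≤ (detFrameSystem k M b).U x) (hy : V ≤ (detFrameSystem k M b).U y) :
    (detFrameSystem k M b).cocycle.g x y V hx hy =
      ((universalChartData k M b).transition (chartAt k M b x) (chartAt k M b y) V hx hy).det := by
  rw [FrameSystem.cocycle_g]
  change transitionDet ((universalChartData k M b).cocycle.frame (chartAt k M b x))
      ((universalChartData k M b).cocycle.frame (chartAt k M b y)) Equiv.ulift Equiv.ulift (homOfLE hx) (homOfLE hy) = _
  rw [transitionDet_eq]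
  unfold stdTransition
  rw [MatrixCocycle.transition_frame, ChartData.cocycle_g]
  exact Matrix.det_submatrix_equiv_self _ _

/-- The universal quotient is finite locally free (★ `MatrixCocycle.isFiniteLocallyFree_glued` at the chart cover).
[cite: GortzWedhorn2020, (8.4) (pp. 213–215)] -/
theorem isFiniteLocallyFree_universalQuotient : IsFiniteLocallyFree (universalQuotient k M b) :=
  (universalChartData k M b).cocycle.isFiniteLocallyFree_glued (exists_mem_universalChartData_U k M b)

/-- **`[det 𝒬] = CechPic.mk (det g)`**: the determinant class of the universal quotient is the class of the determinant cocycle of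
its standard frames (★ `detClass_eq_mk`). [cite: Hartshorne1977, II Ex. 5.16] [cite: Hartshorne1977, II Ex. 6.11] -/
theorem detClass_universalQuotient_eq_mk (hQ : IsFiniteLocallyFree (universalQuotient k M b)) :
    detClass hQ = CechPic.mk (detFrameSystem k M b).cocycle :=
  detClass_eq_mk hQ _

/-! ## §2 The determinant line bundle `det 𝒬` as a cocycle line bundle and the Plücker sections -/

/-- **The Plücker family of the frame `d`**: on the chart of `x` the maximal minor `det (transitionAt (chartAt x) d)` — the determinant of
the `chartAt x`-coordinates of the frame vectors `b (d j)` (★ `ChartData.transitionAt`, defined on the whole chart). [cite: EisenbudHarris2016, §3.2.2] -/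
def pluckerFamily (d : {I : Fin k → J // Function.Injective I}) (x : grassmannianScheme M k) :
    Γ(grassmannianScheme M k, ⊤ ⊓ (detFrameSystem k M b).cocycle.U x) :=
  Modules.secRes (grassmannianScheme M k)
    (inf_le_right : ⊤ ⊓ (detFrameSystem k M b).cocycle.U x ≤ (detFrameSystem k M b).cocycle.U x)
    ((universalChartData k M b).transitionAt (chartAt k M b x) d ((universalChartData k M b).isAffineOpen _) le_rfl).det

/-- Restricting the maximal minor of the chart `a` to an affine `W ≤ U_a` gives the maximal minor over `W` (★ `transitionAt_map` + `RingHom.map_det`).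
[cite: EisenbudHarris2016, §3.2.2] -/
theorem secRes_det_transitionAt (a d : {I : Fin k → J // Function.Injective I}) {W W' : (grassmannianScheme M k).Opens}
    (hW : IsAffineOpen W) (hW' : IsAffineOpen W') (ha : W ≤ (universalChartData k M b).U a) (i : W' ≤ W) :
    Modules.secRes (grassmannianScheme M k) i ((universalChartData k M b).transitionAt a d hW ha).det =
      ((universalChartData k M b).transitionAt a d hW' (i.trans ha)).det := by
  rw [RingHom.map_det, RingHom.mapMatrix_apply, (universalChartData k M b).transitionAt_map a d hW hW' ha i]

/-- **The Plücker family is a glue family for the determinant cocycle**: `det t_{a(x), d} = det g_{a(x) a(y)} · det t_{a(y), d}` on every open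
below `U_{a(x)} ⊓ U_{a(y)}` (★ `transitionAt_mul`, checked on affine opens). [cite: EisenbudHarris2016, §3.2.2] [cite: Hartshorne1977, II Ex. 5.18] -/
theorem isGlueFamily_pluckerFamily (d : {I : Fin k → J // Function.Injective I}) :
    (detFrameSystem k M b).cocycle.IsGlueFamily ⊤ (pluckerFamily k M b d) := by
  intro x y V' hV hx hy
  set D := universalChartData k M b with hD
  refine section_ext_of_affine _ _ fun W hW iW => ?_
  have hxW : W ≤ D.U (chartAt k M b x) := iW.trans hx
  have hyW : W ≤ D.U (chartAt k M b y) := iW.trans hy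
  have h1 : Modules.secRes _ iW (Modules.secRes _ (le_inf hV hx) (pluckerFamily k M b d x)) =
      (D.transitionAt (chartAt k M b x) d hW hxW).det := by
    rw [pluckerFamily, Modules.secRes_secRes, Modules.secRes_secRes]
    exact secRes_det_transitionAt k M b _ d _ hW le_rfl _
  have h2 : Modules.secRes _ iW (Modules.secRes _ (le_inf hV hy) (pluckerFamily k M b d y)) =
      (D.transitionAt (chartAt k M b y) d hW hyW).det := by
    rw [pluckerFamily, Modules.secRes_secRes, Modules.secRes_secRes]
    exact secRes_det_transitionAt k M b _ d _ hW le_rfl _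
  have h3 : Modules.secRes _ iW ((detFrameSystem k M b).cocycle.g x y V' hx hy) =
      (D.transitionAt (chartAt k M b x) (chartAt k M b y) hW hxW).det := by
    rw [detFrameSystem_cocycle_g, RingHom.map_det, RingHom.mapMatrix_apply, D.transition_map _ _ hx hy iW,
      D.transition_eq_of_isAffineOpen _ _ hW, Matrix.det_submatrix_equiv_self]
  rw [map_mul, h1, h2, h3, ← Matrix.det_mul, D.transitionAt_mul _ _ d hW hxW hyW]

/-- **THE PLÜCKER SECTION `p_d ∈ Γ(det 𝒬, Gr)`** of the frame `d` (★ `UnitCocycle.mkSection` of the Plücker family).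
[cite: GortzWedhorn2020, (8.10) Prop. 8.23 (p. 220)] [cite: EisenbudHarris2016, §3.2.2] -/
def pluckerSection (d : {I : Fin k → J // Function.Injective I}) :
    Γ(lineBundle (detFrameSystem k M b).cocycle, ⊤) :=
  (detFrameSystem k M b).cocycle.mkSection ⊤ (pluckerFamily k M b d) (isGlueFamily_pluckerFamily k M b d)

/-- **The coefficient of the Plücker section `p_d` in the canonical frame at `x` is the maximal minor `det t_{a(x), d}`**
(★ `coeffAt` in ★ `lineBundleFrameSystem`; ★ `eq_smul_lineBundleGen`, ★ `basisSection_lineBundleFrame`). [cite: Hartshorne1977, II proof of Thm. 7.1] -/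
theorem coeffAt_pluckerSection {ι₀ : Type} (e : ι₀ → {I : Fin k → J // Function.Injective I}) (i : ι₀)
    (x : grassmannianScheme M k) :
    coeffAt (detFrameSystem k M b).cocycle.lineBundleFrameSystem (detFrameSystem k M b).cocycle.lineBundleFrameSystem_rank
        (fun i => pluckerSection k M b (e i)) i x =
      ((universalChartData k M b).transitionAt (chartAt k M b x) (e i) ((universalChartData k M b).isAffineOpen _) le_rfl).det := by
  classical
  set c := (detFrameSystem k M b).cocycle with hc
  rw [coeffAt]
  have hs := c.eq_smul_lineBundleGen x (c.U x) le_rfl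
    ((lineBundle c).presheaf.map (homOfLE (le_top : c.U x ≤ ⊤)).op (pluckerSection k M b (e i)))
  change coord (c.lineBundleFrame x) (𝟙 (c.U x))
      ((lineBundle c).presheaf.map (homOfLE (le_top : c.U x ≤ ⊤)).op (pluckerSection k M b (e i))) _ = _
  rw [hs, coord_smul, ← c.map_lineBundleGen x le_rfl (𝟙 (c.U x)), ← UnitCocycle.basisSection_lineBundleFrame,
    coord_map_basisSection,
    if_pos (show PUnit.unit = c.lineBundleFrameSystem.idx c.lineBundleFrameSystem_rank x from rfl), mul_one,
    UnitCocycle.comp_map, pluckerSection, UnitCocycle.comp_mkSection,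
    pluckerFamily, Modules.secRes_secRes, Modules.secRes_secRes]
  exact Modules.secRes_self _

/-- The Plücker section of the point's OWN chart has coefficient `1` there (`t_{aa} = 1`, ★ `transitionAt_self`), so `x` lies in its non-vanishing
locus. [cite: EisenbudHarris2016, §3.2.2] -/
theorem mem_basicOpen_coeffAt_pluckerSection_of_eq {ι₀ : Type} (e : ι₀ → {I : Fin k → J // Function.Injective I})
    (x : grassmannianScheme M k) (i : ι₀) (hi : e i = chartAt k M b x) :
    x ∈ (grassmannianScheme M k).basicOpen
      (coeffAt (detFrameSystem k M b).cocycle.lineBundleFrameSystem (detFrameSystem k M b).cocycle.lineBundleFrameSystem_rank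
        (fun i => pluckerSection k M b (e i)) i x) := by
  rw [coeffAt_pluckerSection, hi, (universalChartData k M b).transitionAt_self, Matrix.det_one,
    (grassmannianScheme M k).basicOpen_of_isUnit isUnit_one]
  exact mem_U_chartAt k M b x

/-! ## §3 The Plücker cocycle-sections datum and the generating-sections datum -/

section Datum

variable {n : ℕ} (e : Fin (n + 1) → {I : Fin k → J // Function.Injective I})

/-- The cocycle-sections datum of the Plücker sections `p_{e 0}, …, p_{e n}` in the canonical frame of `det 𝒬`
(★ `CocycleSections.ofFrameSystem`). [cite: Hartshorne1977, II proof of Thm. 7.1] -/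
abbrev pluckerCocycleSections :
    CocycleSections (Fin (n + 1)) (detFrameSystem k M b).cocycle.lineBundleFrameSystem.U :=
  CocycleSections.ofFrameSystem (detFrameSystem k M b).cocycle.lineBundleFrameSystem
    (detFrameSystem k M b).cocycle.lineBundleFrameSystem_rank (fun i => pluckerSection k M b (e i))

/-- **The Plücker sections generate** as soon as every chart occurs among the `e i`: at `x` the section `p_{chartAt x}` has coefficient `1`.
[cite: Hartshorne1977, II Thm. 7.1] [cite: EisenbudHarris2016, §3.2.2] -/
theorem iSup_basicOpen_coeff_pluckerCocycleSections_eq_top (he : Function.Surjective e) :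
    ⨆ i, ⨆ x, (grassmannianScheme M k).basicOpen ((pluckerCocycleSections k M b e).coeff i x) = ⊤ := by
  rw [CocycleSections.ofFrameSystem_coeff, iSup_basicOpen_coeffAt_eq_top_iff]
  intro p
  obtain ⟨i, hi⟩ := he (chartAt k M b p)
  exact ⟨i, mem_basicOpen_coeffAt_pluckerSection_of_eq k M b e p i hi⟩

/-- **THE PLÜCKER GENERATING-SECTIONS DATUM** on `Gr` (★ `GeneratingSections.ofCocycleSections` of the Plücker sections of `det 𝒬`).
[cite: Hartshorne1977, II Thm. 7.1] [cite: GortzWedhorn2020, (8.10) Prop. 8.23 (p. 220)] -/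
abbrev pluckerDatum (he : Function.Surjective e) : GeneratingSections (Fin (n + 1)) (grassmannianScheme M k) :=
  ofCocycleSections _ (pluckerCocycleSections k M b e) (iSup_basicOpen_coeff_pluckerCocycleSections_eq_top k M b e he)

end Datum

end Literature.AlgebraicGeometry.Motives.Grassmannian

end
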